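import Mathlib
import Summits.ResolutionOfSingularities.ResolutionOfSingularities.Theorems.WildQuotientsWildQuotientResolutionQuotientPhaseZeroNormalCrux
import Literature.AlgebraicGeometry.RelativeSpec.FiniteGroupQuotientGluedProperties
import Literature.AlgebraicGeometry.Resolution.BlowupsProperProofs
import Literature.AlgebraicGeometry.Resolution.RegularLocalRingsNormal
import Summits.ResolutionOfSingularities.ResolutionOfSingularities.Theorems.WildQuotientsWildQuotientResolutionBirationalOfSection
import Summits.ResolutionOfSingularities.ResolutionOfSingularities.Theorems.WildQuotientsWildQuotientResolutionNormalizationStableCover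
import Summits.ResolutionOfSingularities.ResolutionOfSingularities.Theorems.WildQuotientsWildQuotientResolutionNormalizationToBase
import HarnessLib

/-!
# The conditional NORMAL Phase-0 model over `X′`, assembled (crux `WildQuotients.WildQuotientResolution`, stub `stub_phaseZeroHighDim`)

Crux stmt-ResolutionOfSingularities-15640 (`WildQuotientResolution`), line `Sketch`, registered stub
`stub_phaseZeroHighDim` asks, for the crux data with `X′` REGULAR, for a `G`-equivariant proper birational
REGULAR model `Xs → X′` all of whose inertia groups are p-closed, with a `G`-stable affine cover. This file
assembles what the Abbes–Saito route gives today, CONDITIONALLY on the typed named fact AS2011 Prop. 2.22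
(`AbbesSaito2011_inertiaNormalSylow_after_admissibleBlowup`) and with `X′` only NORMAL:

**Theorem** (`exists_normalModel_forall_hasNormalSylow`). There are an INTEGRAL scheme `Xs` with an action
`ρs` of `G`, a `G`-EQUIVARIANT morphism `πs : Xs → X′`, a dense open `V ⊆ X′` (the preimage of the étale
locus of the quotient map `X′ → X′/G`) with a `G`-equivariant morphism `j : V → Xs` such that `j ≫ πs` is the
inclusion `V ↪ X′` and `j` is dominant, and EVERY inertia group of `ρs` is p-closed.

Here `Xs = f′.normalization` is the integral closure of the `W`-admissible blow-up `Y₁′` of the quotient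
`Y₁ = X′/G` in `V` (✓`QuotientPhaseZeroNormal.exists_quotient_admissibleBlowup_forall_hasNormalSylow`,
p812284) and `πs` is the equivariant morphism of ✓`NormalizationToBase.exists_equivariant_hom_normalization`
(p812308). MISSING with respect to the registered stub (memo PHASE0-AS2011-v3.md, census): `IsProper πs`
(finiteness of integral closure — Nagata), `IsBirational πs` in the tree's sense (normalisation commutes with
restriction to the open `φ⁻¹W ≅ W` over which `V` is finite: Mathlib `normalizationPullback`,
`IsIso toNormalization` for integral morphisms — M), the `G`-stable affine cover (from `Xs → Y₁′` affine and
`Y₁′ → Spec k` separated — S/M), and REGULARITY of `Xs` (R3, open in dimension `≥ 4`).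

[OURS · crux stmt-ResolutionOfSingularities-15640 · helper toward `stub_phaseZeroHighDim`, CONDITIONAL on
AS2011 Prop. 2.22; counted 0; AI-level work, weaker than expert review.]
-/

-- single-problem summit: the doubled namespace component `ResolutionOfSingularities` is forced
set_option linter.dupNamespace false

noncomputable section

open CategoryTheory CategoryTheory.Limits AlgebraicGeometry TopologicalSpace
open Literature.AlgebraicGeometry.Ramification Literature.AlgebraicGeometry.RelativeSpec
open Literature.AlgebraicGeometry.Resolution

namespace Summit.ResolutionOfSingularities.ResolutionOfSingularities.Theorems.WildQuotientResolution.PhaseZeroNormalModel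

set_option maxHeartbeats 800000 in
/-- **The conditional normal Phase-0 model over `X′`** (see the module docstring): integral `Xs`, action
`ρs`, equivariant `πs : Xs → X′` which is the identity on the dense `G`-stable open `V ⊆ X′` (through the
dominant equivariant `j : V → Xs`), and p-closed inertia everywhere on `Xs`.
[cite: AbbesSaito2011, Prop. 2.22 (NS4), 2.4] [cite: StacksProject, Tag 035I] [cite: SGA1, Exp. V, 2.6] -/
theorem exists_normalModel_forall_hasNormalSylow
    (hAS : AbbesSaito2011_inertiaNormalSylow_after_admissibleBlowup.{0})
    (ℓ : ℕ) [Fact ℓ.Prime] (k : Type) [Field k] [CharP k ℓ]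
    (X' X₁ : Scheme.{0}) (f : X₁ ⟶ Spec (.of k)) (q : X' ⟶ X₁) (G : Type) [Group G] [Finite G]
    (ρ : G →* Aut X') (hfaith : Function.Injective ρ)
    [IsSeparated f] [LocallyOfFiniteType f] [QuasiCompact f] [IsIntegral X'] [IsFinite q]
    (hnorm : ∀ x : X', IsIntegrallyClosed (X'.presheaf.stalk x))
    (hρ : ∀ g : G, (ρ g).hom ≫ q = q) :
    ∃ (Xs : Scheme.{0}) (πs : Xs ⟶ X') (ρs : G →* Aut Xs) (V : X'.Opens)
      (ρV : G →* Aut (V : Scheme.{0})) (j : (V : Scheme.{0}) ⟶ Xs),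
      IsIntegral Xs ∧ Dense (V : Set X') ∧
      (∀ g : G, (ρs g).hom ≫ πs = πs ≫ (ρ g).hom) ∧
      (∀ g : G, (ρV g).hom ≫ V.ι = V.ι ≫ (ρ g).hom) ∧
      (∀ g : G, (ρV g).hom ≫ j = j ≫ (ρs g).hom) ∧
      j ≫ πs = V.ι ∧ IsDominant j ∧
      ∀ x : Xs, HasNormalSylow ℓ (inertiaSubgroup ρs x) := by
  classical
  haveI : X₁.IsSeparated := ⟨by rw [← terminal.comp_from f]; infer_instance⟩
  haveI : X'.IsSeparated := ⟨by rw [← terminal.comp_from (q ≫ f)]; infer_instance⟩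
  -- the glued quotient over `Spec k` (as in `QuotientPhaseZeroNormal`)
  let ρk : ActionOver (q ≫ f) G := ⟨ρ, fun g => by rw [← Category.assoc, hρ g]⟩
  have hcov : ∀ x : X', ∃ O : ρk.StableAffineOpens, x ∈ O.1 :=
    QuotientPhaseZeroNormal.exists_stableAffineOpens_mem f q ρ hρ
  have hinj : Function.Injective ρk.aut := hfaith
  haveI : IsIntegral ρk.glued := ρk.isIntegral_glued hcov
  have hnormY : ∀ y : ρk.glued, IsIntegrallyClosed (ρk.glued.presheaf.stalk y) :=
    QuotientModelNormal.isIntegrallyClosed_stalk_glued_of_stalk ρk hcov hnorm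
  obtain ⟨W, hWd, hWet⟩ := exists_dense_etale_gluedMk_morphismRestrict ρk hcov hinj
  haveI := hWet
  obtain ⟨ρW, hρW, Q', φ, I, hb, hfg, hdisj, f', hqc, hqs, hρ', hf', hNS⟩ :=
    QuotientPhaseZeroNormal.exists_admissibleBlowup_glued_forall_hasNormalSylow hAS ℓ (q ≫ f) ρk hinj
      hcov hnormY W hWd
  haveI := hqc
  haveI := hqs
  haveI : IsFinite (ρk.gluedMk hcov) := ρk.isFinite_gluedMk hcov
  -- the equivariant morphism `f'.normalization → X′`
  have hsq : (ρk.gluedMk hcov ⁻¹ᵁ W).ι ≫ ρk.gluedMk hcov = f' ≫ φ := by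
    rw [hf', morphismRestrict_ι]
  obtain ⟨πs, hj, -, hequiv⟩ :=
    NormalizationToBase.exists_equivariant_hom_normalization (ρk.gluedMk hcov ⁻¹ᵁ W).ι
      (ρk.gluedMk hcov) φ f' hsq ρW ρk.aut hρ' (ρk.aut_hom_gluedMk hcov) hρW
  -- the dense `G`-stable open `V = π⁻¹W`
  have hVne : ((ρk.gluedMk hcov ⁻¹ᵁ W : X'.Opens) : Set X').Nonempty := by
    obtain ⟨y, hy⟩ := hWd.nonempty
    obtain ⟨x, rfl⟩ := ρk.gluedMk_surjective hcov y
    exact ⟨x, hy⟩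
  haveI : Nonempty ((ρk.gluedMk hcov ⁻¹ᵁ W : X'.Opens) : Scheme.{0}) := ⟨⟨_, hVne.some_mem⟩⟩
  haveI : IsIntegral ((ρk.gluedMk hcov ⁻¹ᵁ W : X'.Opens) : Scheme.{0}) :=
    isIntegral_of_isOpenImmersion (ρk.gluedMk hcov ⁻¹ᵁ W).ι
  refine ⟨f'.normalization, πs, normalizationAction f' ρW hρ', ρk.gluedMk hcov ⁻¹ᵁ W, ρW,
    f'.toNormalization, inferInstance, (ρk.gluedMk hcov ⁻¹ᵁ W).2.dense hVne, hequiv, hρW,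
    fun g => (toNormalization_normalizationAction_hom f' ρW hρ' g).symm, hj, inferInstance, hNS⟩

set_option maxHeartbeats 800000 in
/-- **The conditional normal Phase-0 model with all classical clauses but properness** (conditional on
AS2011 Prop. 2.22, `X′` normal): an INTEGRAL `Xs` with an action `ρs`, a SEPARATED, BIRATIONAL
(tree `Resolution.IsBirational`), `G`-EQUIVARIANT `πs : Xs → X′`, p-closed inertia at every point of `Xs`,
and a `G`-stable affine open neighbourhood of every point — i.e. every clause of `stub_phaseZeroHighDim`
except `IsProper πs` (finiteness of integral closure, census R2b) and `Scheme.IsRegular Xs` (R3, open in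
dimension `≥ 4`). Assembled from `exists_normalModel_forall_hasNormalSylow`'s construction with
✓`NormalizationToBase.exists_equivariant_isSeparated_hom_normalization` (separatedness: `Y₁′ → Y₁` is a
blow-up in a finite-type ideal, hence proper, ✓`IsBlowup.isProper_of_fg`),
✓`BirationalOfSection.isBirational_of_section` and ✓`NormalizationStableCover.exists_stable_affineOpen_normalization`.
[cite: AbbesSaito2011, Prop. 2.22 (NS4), 2.4] [cite: StacksProject, Tag 035I] [cite: SGA1, Exp. V, 2.6] -/
theorem exists_normalModel_isBirational_forall_hasNormalSylow
    (hAS : AbbesSaito2011_inertiaNormalSylow_after_admissibleBlowup.{0})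
    (ℓ : ℕ) [Fact ℓ.Prime] (k : Type) [Field k] [CharP k ℓ]
    (X' X₁ : Scheme.{0}) (f : X₁ ⟶ Spec (.of k)) (q : X' ⟶ X₁) (G : Type) [Group G] [Finite G]
    (ρ : G →* Aut X') (hfaith : Function.Injective ρ)
    [IsSeparated f] [LocallyOfFiniteType f] [QuasiCompact f] [IsIntegral X'] [IsFinite q]
    (hnorm : ∀ x : X', IsIntegrallyClosed (X'.presheaf.stalk x))
    (hρ : ∀ g : G, (ρ g).hom ≫ q = q) :
    ∃ (Xs : Scheme.{0}) (πs : Xs ⟶ X') (ρs : G →* Aut Xs),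
      IsIntegral Xs ∧ IsSeparated πs ∧ IsBirational πs ∧
      (∀ g : G, (ρs g).hom ≫ πs = πs ≫ (ρ g).hom) ∧
      (∀ x : Xs, HasNormalSylow ℓ (inertiaSubgroup ρs x)) ∧
      ∀ x : Xs, ∃ U : Xs.Opens, IsAffineOpen U ∧ x ∈ U ∧ ∀ g : G, (ρs g).hom ⁻¹ᵁ U = U := by
  classical
  haveI : X₁.IsSeparated := ⟨by rw [← terminal.comp_from f]; infer_instance⟩
  haveI : X'.IsSeparated := ⟨by rw [← terminal.comp_from (q ≫ f)]; infer_instance⟩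
  let ρk : ActionOver (q ≫ f) G := ⟨ρ, fun g => by rw [← Category.assoc, hρ g]⟩
  have hcov : ∀ x : X', ∃ O : ρk.StableAffineOpens, x ∈ O.1 :=
    QuotientPhaseZeroNormal.exists_stableAffineOpens_mem f q ρ hρ
  have hinj : Function.Injective ρk.aut := hfaith
  haveI : IsIntegral ρk.glued := ρk.isIntegral_glued hcov
  have hnormY : ∀ y : ρk.glued, IsIntegrallyClosed (ρk.glued.presheaf.stalk y) :=
    QuotientModelNormal.isIntegrallyClosed_stalk_glued_of_stalk ρk hcov hnorm
  obtain ⟨W, hWd, hWet⟩ := exists_dense_etale_gluedMk_morphismRestrict ρk hcov hinj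
  haveI := hWet
  obtain ⟨ρW, hρW, Q', φ, I, hb, hfg, hdisj, f', hqc, hqs, hρ', hf', hNS⟩ :=
    QuotientPhaseZeroNormal.exists_admissibleBlowup_glued_forall_hasNormalSylow hAS ℓ (q ≫ f) ρk hinj
      hcov hnormY W hWd
  haveI := hqc
  haveI := hqs
  haveI : IsFinite (ρk.gluedMk hcov) := ρk.isFinite_gluedMk hcov
  haveI : IsProper φ := IsBlowup.isProper_of_fg hfg hb
  -- the separated equivariant morphism `f'.normalization → X′`
  have hsq : (ρk.gluedMk hcov ⁻¹ᵁ W).ι ≫ ρk.gluedMk hcov = f' ≫ φ := by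
    rw [hf', morphismRestrict_ι]
  obtain ⟨πs, hsep, hj, -, hequiv⟩ :=
    NormalizationToBase.exists_equivariant_isSeparated_hom_normalization (ρk.gluedMk hcov ⁻¹ᵁ W).ι
      (ρk.gluedMk hcov) φ f' hsq ρW ρk.aut hρ' (ρk.aut_hom_gluedMk hcov) hρW
  haveI := hsep
  -- the dense `G`-stable open `V = π⁻¹W`
  have hVne : ((ρk.gluedMk hcov ⁻¹ᵁ W : X'.Opens) : Set X').Nonempty := by
    obtain ⟨y, hy⟩ := hWd.nonempty
    obtain ⟨x, rfl⟩ := ρk.gluedMk_surjective hcov y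
    exact ⟨x, hy⟩
  haveI : Nonempty ((ρk.gluedMk hcov ⁻¹ᵁ W : X'.Opens) : Scheme.{0}) := ⟨⟨_, hVne.some_mem⟩⟩
  haveI : IsIntegral ((ρk.gluedMk hcov ⁻¹ᵁ W : X'.Opens) : Scheme.{0}) :=
    isIntegral_of_isOpenImmersion (ρk.gluedMk hcov ⁻¹ᵁ W).ι
  refine ⟨f'.normalization, πs, normalizationAction f' ρW hρ', inferInstance, hsep,
    BirationalOfSection.isBirational_of_section πs (ρk.gluedMk hcov ⁻¹ᵁ W) f'.toNormalization hj
      ((ρk.gluedMk hcov ⁻¹ᵁ W).2.dense hVne),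
    hequiv, hNS, NormalizationStableCover.exists_stable_affineOpen_normalization f' ρW hρ'⟩

set_option maxHeartbeats 800000 in
/-- **The conditional normal Phase-0 model with ALL clauses of `stub_phaseZeroHighDim` except regularity**,
conditional on AS2011 Prop. 2.22 AND on finiteness of relative normalisation over `k` (E. Noether / Nagata;
hypothesis `hfin`, cf. the tree's named fact `Resolution.NoetherFiniteIntegralClosure`), for `X′` normal:
an INTEGRAL `Xs` with an action `ρs`, a PROPER, BIRATIONAL, `G`-EQUIVARIANT `πs : Xs → X′`, p-closed
inertia at every point of `Xs`, and a `G`-stable affine open neighbourhood of every point. The only clause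
of the registered stub not delivered is `Scheme.IsRegular Xs` — the open residual R3 (an equivariant
regular model dominating `Xs` = equivariant principalisation in dimension `≥ 4`).
[cite: AbbesSaito2011, Prop. 2.22 (NS4), 2.4] [cite: StacksProject, Tag 035I] [cite: Liu2002, Prop. 4.1.27] -/
theorem exists_normalModel_isProper_forall_hasNormalSylow
    (hAS : AbbesSaito2011_inertiaNormalSylow_after_admissibleBlowup.{0})
    (ℓ : ℕ) [Fact ℓ.Prime] (k : Type) [Field k] [CharP k ℓ]
    (hfin : ∀ (V Q : Scheme.{0}) (g : V ⟶ Q) [QuasiCompact g] [QuasiSeparated g] [IsIntegral V]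
      (s : Q ⟶ Spec (.of k)) [LocallyOfFiniteType s] [LocallyOfFiniteType g], IsFinite g.fromNormalization)
    (X' X₁ : Scheme.{0}) (f : X₁ ⟶ Spec (.of k)) (q : X' ⟶ X₁) (G : Type) [Group G] [Finite G]
    (ρ : G →* Aut X') (hfaith : Function.Injective ρ)
    [IsSeparated f] [LocallyOfFiniteType f] [QuasiCompact f] [IsIntegral X'] [IsFinite q]
    (hnorm : ∀ x : X', IsIntegrallyClosed (X'.presheaf.stalk x))
    (hρ : ∀ g : G, (ρ g).hom ≫ q = q) :
    ∃ (Xs : Scheme.{0}) (πs : Xs ⟶ X') (ρs : G →* Aut Xs),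
      IsIntegral Xs ∧ IsProper πs ∧ IsBirational πs ∧
      (∀ g : G, (ρs g).hom ≫ πs = πs ≫ (ρ g).hom) ∧
      (∀ x : Xs, HasNormalSylow ℓ (inertiaSubgroup ρs x)) ∧
      ∀ x : Xs, ∃ U : Xs.Opens, IsAffineOpen U ∧ x ∈ U ∧ ∀ g : G, (ρs g).hom ⁻¹ᵁ U = U := by
  classical
  haveI : X₁.IsSeparated := ⟨by rw [← terminal.comp_from f]; infer_instance⟩
  haveI : X'.IsSeparated := ⟨by rw [← terminal.comp_from (q ≫ f)]; infer_instance⟩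
  let ρk : ActionOver (q ≫ f) G := ⟨ρ, fun g => by rw [← Category.assoc, hρ g]⟩
  have hcov : ∀ x : X', ∃ O : ρk.StableAffineOpens, x ∈ O.1 :=
    QuotientPhaseZeroNormal.exists_stableAffineOpens_mem f q ρ hρ
  have hinj : Function.Injective ρk.aut := hfaith
  haveI : IsIntegral ρk.glued := ρk.isIntegral_glued hcov
  haveI : LocallyOfFiniteType (ρk.gluedDesc (q ≫ f) ρk.aut_comp) := ρk.locallyOfFiniteType_gluedDesc_base
  have hnormY : ∀ y : ρk.glued, IsIntegrallyClosed (ρk.glued.presheaf.stalk y) :=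
    QuotientModelNormal.isIntegrallyClosed_stalk_glued_of_stalk ρk hcov hnorm
  obtain ⟨W, hWd, hWet⟩ := exists_dense_etale_gluedMk_morphismRestrict ρk hcov hinj
  haveI := hWet
  obtain ⟨ρW, hρW, Q', φ, I, hb, hfg, hdisj, f', hqc, hqs, hρ', hf', hNS⟩ :=
    QuotientPhaseZeroNormal.exists_admissibleBlowup_glued_forall_hasNormalSylow hAS ℓ (q ≫ f) ρk hinj
      hcov hnormY W hWd
  haveI := hqc
  haveI := hqs
  haveI : IsFinite (ρk.gluedMk hcov) := ρk.isFinite_gluedMk hcov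
  haveI : IsProper φ := IsBlowup.isProper_of_fg hfg hb
  -- the dense `G`-stable open `V = π⁻¹W` is integral
  have hVne : ((ρk.gluedMk hcov ⁻¹ᵁ W : X'.Opens) : Set X').Nonempty := by
    obtain ⟨y, hy⟩ := hWd.nonempty
    obtain ⟨x, rfl⟩ := ρk.gluedMk_surjective hcov y
    exact ⟨x, hy⟩
  haveI : Nonempty ((ρk.gluedMk hcov ⁻¹ᵁ W : X'.Opens) : Scheme.{0}) := ⟨⟨_, hVne.some_mem⟩⟩
  haveI : IsIntegral ((ρk.gluedMk hcov ⁻¹ᵁ W : X'.Opens) : Scheme.{0}) :=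
    isIntegral_of_isOpenImmersion (ρk.gluedMk hcov ⁻¹ᵁ W).ι
  -- finiteness of the normalisation `f'.normalization → Q'` (hypothesis `hfin`)
  have hsq : (ρk.gluedMk hcov ⁻¹ᵁ W).ι ≫ ρk.gluedMk hcov = f' ≫ φ := by
    rw [hf', morphismRestrict_ι]
  haveI : LocallyOfFiniteType (f' ≫ φ) := by rw [← hsq]; infer_instance
  haveI : LocallyOfFiniteType f' := locallyOfFiniteType_of_comp f' φ
  haveI : IsFinite f'.fromNormalization := hfin _ _ f' (φ ≫ ρk.gluedDesc (q ≫ f) ρk.aut_comp)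
  -- the proper equivariant morphism `f'.normalization → X′`
  obtain ⟨πs, hprop, hj, -, hequiv⟩ :=
    NormalizationToBase.exists_equivariant_isProper_hom_normalization (ρk.gluedMk hcov ⁻¹ᵁ W).ι
      (ρk.gluedMk hcov) φ f' hsq ρW ρk.aut hρ' (ρk.aut_hom_gluedMk hcov) hρW
  haveI := hprop
  refine ⟨f'.normalization, πs, normalizationAction f' ρW hρ', inferInstance, hprop,
    BirationalOfSection.isBirational_of_section πs (ρk.gluedMk hcov ⁻¹ᵁ W) f'.toNormalization hj
      ((ρk.gluedMk hcov ⁻¹ᵁ W).2.dense hVne),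
    hequiv, hNS, NormalizationStableCover.exists_stable_affineOpen_normalization f' ρW hρ'⟩

/-- **The same for `X′` REGULAR — the hypothesis list of `stub_phaseZeroHighDim`** (regular local rings are
integrally closed, Matsumura Thm. 19.4, ✓`Resolution.isIntegrallyClosed_of_isRegularLocalRing`): conditional
on AS2011 Prop. 2.22 and on finiteness of relative normalisation over `k`, the crux data with `X′` regular
admit an integral `Xs` with a `G`-action and a PROPER, BIRATIONAL, EQUIVARIANT `πs : Xs → X′` with p-closed
inertia everywhere and a `G`-stable affine cover. Compared with the registered stub (which also assumes
`dim X′ ≥ 3`, unused here), exactly the conjunct `Scheme.IsRegular Xs` is missing: the open residual.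
[cite: AbbesSaito2011, Prop. 2.22 (NS4)] [cite: Matsumura1987, Thm. 19.4] [cite: Liu2002, Prop. 4.1.27] -/
theorem exists_normalModel_of_isRegular
    (hAS : AbbesSaito2011_inertiaNormalSylow_after_admissibleBlowup.{0})
    (ℓ : ℕ) [Fact ℓ.Prime] (k : Type) [Field k] [CharP k ℓ]
    (hfin : ∀ (V Q : Scheme.{0}) (g : V ⟶ Q) [QuasiCompact g] [QuasiSeparated g] [IsIntegral V]
      (s : Q ⟶ Spec (.of k)) [LocallyOfFiniteType s] [LocallyOfFiniteType g], IsFinite g.fromNormalization)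
    (X' X₁ : Scheme.{0}) (f : X₁ ⟶ Spec (.of k)) (q : X' ⟶ X₁) (G : Type) [Group G] [Finite G]
    (ρ : G →* Aut X') (hfaith : Function.Injective ρ)
    [IsSeparated f] [LocallyOfFiniteType f] [QuasiCompact f] [IsIntegral X'] (hreg : Scheme.IsRegular X')
    [IsFinite q] (hρ : ∀ g : G, (ρ g).hom ≫ q = q) :
    ∃ (Xs : Scheme.{0}) (πs : Xs ⟶ X') (ρs : G →* Aut Xs),
      IsIntegral Xs ∧ IsProper πs ∧ IsBirational πs ∧
      (∀ g : G, (ρs g).hom ≫ πs = πs ≫ (ρ g).hom) ∧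
      (∀ x : Xs, HasNormalSylow ℓ (inertiaSubgroup ρs x)) ∧
      ∀ x : Xs, ∃ U : Xs.Opens, IsAffineOpen U ∧ x ∈ U ∧ ∀ g : G, (ρs g).hom ⁻¹ᵁ U = U :=
  exists_normalModel_isProper_forall_hasNormalSylow hAS ℓ k hfin X' X₁ f q G ρ hfaith
    (fun x => haveI := hreg x; isIntegrallyClosed_of_isRegularLocalRing (X'.presheaf.stalk x)) hρ

end Summit.ResolutionOfSingularities.ResolutionOfSingularities.Theorems.WildQuotientResolution.PhaseZeroNormalModel

end
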